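import Summits.AtomisticToContinuum.Crystallization.Theorems.FrustratedLawDichotomyStrainedPatchHomValueT2TrackFast

/-!
# G5′ TRACK edition, part 3 (price lever L5 «CLASS-LEVEL REMAINDER TENSORS»): the near leaf with every BOX-HULL quantity amortised over a class of boxes
# (27623 `(H) HomFloor`, hcp half, E-piece NEAR boxes; decomp-a2c hand-1 g48 — critic row 1666 (C) PRICE-OVER-49 «wall target ≤ 13 s/box fused»)

OBSERVATION (NEARGATE5-hand-1-g48 §6): of the fused evaluator's ≈ 24 s/box, ≈ 19 s are INTERVAL work on the BOX records (third-derivative hulls `Λ`, the slope's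
second-derivative hulls, value hulls) and ≈ 1 s is the POINT pass (`passP`: thin intervals).  Every box-hull quantity enters the bound only as a supremum over the
box, so it may be replaced by the supremum over any CLASS box `K ⊇` the member's track product box — computed ONCE per class and contracted with each member's OWN
half-widths:
* `penJ_box = (1/6SC²)·Σ_{abm} Λ^K_abm w_a w_b w_m` (`Λ^K = Σ_{b lip on K} sup_K |T_b,abm|`, the Design-J tensor, UNcontracted),
* `pen0_box = (1/2SC²)·Σ_{kl} R^K_kl w_k w_l` (`R^K_kl = Σ_{b ¬lip on K} width_K(H_b,kl)` bounds `|H_b(x) − H_b(x_c)|` for `x, x_c ∈ K`),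
* slope: `r_a = (1/2SC²)·Σ_{kl} S^K_{a,kl} |δ_k||δ_l|` (`S^K = Σ_{b lip} sup_K|∂_k∂_lF_{b,a}|`), `h_a = (1/SC)·Σ_e J^K_{ae} w_e` (`J^K = Σ_{b ¬lip} sup_K|JF_{b,ae}|`),
while the POINT data (`V₀`, `g^c`, `H^c`, `F^c`, the cancelling point Jacobian `Σ_{b lip} JF^c_b`) stay per box.  The lip/hull split of a label is decided ON THE
CLASS box (so a member box never treats a label more finely than the class tensors assume).  Membership `box ⊆ K` is an integer check (`memberOK`).
Per box this leaves the point pass + `valueP` + two contractions (≈ 2–3 s in the interpreter); the class pass (≈ the old per-box cost) is paid once per class.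

DEFINITIONS ONLY; soundness = the (I1)-type debts of parts 1–2 plus `sup_box ≤ sup_K` for `box ⊆ K`; NOT claimed.  0 sorry; no instances / notation / `#eval`.
`--supports stmt-AtomisticToContinuum-27623`.
-/

namespace Summit.AtomisticToContinuum.Crystallization.Theorems.FrustratedLawDichotomyStrainedPatchHomValueT2Kit

open Literature.Analysis.ValidatedNumerics.Numerics
open Summit.AtomisticToContinuum.Crystallization.Theorems.FrustratedLawDichotomyStrainedPatchHomEntryGram (cen rad)
open Summit.AtomisticToContinuum.Crystallization.Theorems.FrustratedLawDichotomyStrainedPatchHomEntryGramHcp (shufFI dot3)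
open Summit.AtomisticToContinuum.Crystallization.Theorems.FrustratedLawDichotomyStrainedPatchHomCurvCentreKit (boxE cenE cenX)

/-! ## §18. The class pass -/

/-- Class data: guard, the class track product box, label lists with the lip split decided on the class box, and the four UNcontracted hull tensors
(`SC` units): `lam` (9×9×9, filled on sorted triples `a ≤ b ≤ m`, multiplicity folded in), `r0` (81), `s2` (3×81, filled on `k ≤ l`, multiplicity folded in),
`jh` (3×6). -/
structure ClassData where
  /-- dispatch guard of the class pass -/
  ok : Bool
  /-- class centre (entries + shuffle) -/
  cK : (Fin 3 × Fin 3) ⊕ Fin 3 → ℤ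
  /-- class track-product half-widths -/
  wK : (Fin 3 × Fin 3) ⊕ Fin 3 → ℤ
  /-- `A`-family labels near on the class box -/
  LA : List (Fin 3 → ℤ)
  /-- `B`-family labels near on the class box, Lipschitz class on the class box -/
  LBlip : List (Fin 3 → ℤ)
  /-- `B`-family labels near on the class box, hull class on the class box -/
  LBhull : List (Fin 3 → ℤ)
  /-- `Λ^K_abm` with multiplicity (index `81a + 9b + m`, `a ≤ b ≤ m`) -/
  lam : Array ℤ
  /-- `R^K_kl` (index `9k + l`) -/
  r0 : Array ℤ
  /-- `S^K_{a,kl}` with multiplicity (index `81a + 9k + l`, `k ≤ l`) -/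
  s2 : Array ℤ
  /-- `J^K_{ae}` (index `6a + e`) -/
  jh : Array ℤ

/-- Number of distinct arrangements of the multiset `{a, b, m}` (`6 / |stabiliser|`). -/
def mult3 (a b m : ℕ) : ℤ := if a = b ∧ b = m then 1 else if a = b ∨ b = m ∨ a = m then 3 else 6

/-- ★ **THE CLASS PASS** over the class box `(cK, wK)` (`wK` = class ENTRY half-widths and shuffle slack; the class track range is added by `trackW`). -/
def classPass (cK wK : (Fin 3 × Fin 3) ⊕ Fin 3 → ℤ) (aP : Fin 3 → Fin 6 → ℤ) : ClassData :=
  let wK' := trackW aP wK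
  let LA := nearAf cK wK'
  let LB := nearBf cK wK'
  let EF := boxE cK wK'
  let XF := shufFI cK wK'
  -- A family: Λ (UUU block) for lip labels, R (UU block) for hull labels
  let stepLam := fun (top : ℕ) (lam : Array ℤ) (Rb : DRec) =>
    (List.range top).foldl (fun L a => (List.range top).foldl (fun L2 b => if b < a then L2 else (List.range top).foldl (fun L3 m =>
      if m < b then L3 else
        let i := 81 * a + 9 * b + m
        L3.set! i (L3.getD i 0 + mult3 a b m * (thirdOf Rb a b m).absHi)) L2) L) lam
  let stepR0 := fun (maskX : Bool) (r0 : Array ℤ) (Rb : DRec) =>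
    let Hb := hessOf Rb maskX
    Array.ofFn fun n : Fin 81 => r0.getD n.val 0 + ((Hb.getD n.val fi0).hi - (Hb.getD n.val fi0).lo)
  let A0 : Bool × Array ℤ × Array ℤ := (true, Array.replicate 729 0, Array.replicate 81 0)
  let A1 := LA.foldl (fun (S : Bool × Array ℤ × Array ℤ) b =>
    match mkDRec 6 EF (pA b) with
    | none => (false, S.2.1, S.2.2)
    | some Rb => if Rb.co.lip then (S.1, stepLam 6 S.2.1 Rb, S.2.2) else (S.1, S.2.1, stepR0 true S.2.2 Rb)) A0
  -- B family: Λ / R as above (top 9), plus the slope tensors and the lip split lists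
  let B0 : (Bool × Array ℤ × Array ℤ) × (Array ℤ × Array ℤ) × (List (Fin 3 → ℤ) × List (Fin 3 → ℤ)) :=
    (A1, (Array.replicate 243 0, Array.replicate 18 0), ([], []))
  let B1 := LB.foldl (fun (S : (Bool × Array ℤ × Array ℤ) × (Array ℤ × Array ℤ) × (List (Fin 3 → ℤ) × List (Fin 3 → ℤ))) b =>
    match mkDRec 9 EF (qB XF b) with
    | none => ((false, S.1.2.1, S.1.2.2), S.2.1, S.2.2)
    | some Rb =>
      if Rb.co.lip then
        let s2 := (List.range 3).foldl (fun T a =>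
          let aa : Fin 3 := ⟨a % 3, by omega⟩
          (List.range 9).foldl (fun T2 k => (List.range 9).foldl (fun T3 l =>
            if l < k then T3 else
              let i := 81 * a + 9 * k + l
              T3.set! i (T3.getD i 0 + (if k = l then 1 else 2) * (ddF Rb aa k l).absHi)) T2) T) S.2.1.1
        ((S.1.1, stepLam 9 S.1.2.1 Rb, S.1.2.2), (s2, S.2.1.2), (b :: S.2.2.1, S.2.2.2))
      else
        let jh := Array.ofFn fun n : Fin 18 => S.2.1.2.getD n.val 0 + (jF aP Rb ⟨n.val / 6, by omega⟩ (n.val % 6)).absHi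
        ((S.1.1, S.1.2.1, stepR0 false S.1.2.2 Rb), (S.2.1.1, jh), (S.2.2.1, b :: S.2.2.2))) B0
  ⟨B1.1.1, cK, wK', LA, B1.2.2.1.reverse, B1.2.2.2.reverse, B1.1.2.1, B1.1.2.2, B1.2.1.1, B1.2.1.2⟩

/-! ## §19. The member-box pass -/

/-- ★ Membership: the member's track product box `(c, w')` lies inside the class track product box. -/
def memberOK (K : ClassData) (c w' : (Fin 3 × Fin 3) ⊕ Fin 3 → ℤ) : Bool :=
  decide (∀ ab : Fin 3 × Fin 3, |c (Sum.inl ab) - K.cK (Sum.inl ab)| + w' (Sum.inl ab) ≤ K.wK (Sum.inl ab)) &&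
    decide (∀ i : Fin 3, |c (Sum.inr i) - K.cK (Sum.inr i)| + w' (Sum.inr i) ≤ K.wK (Sum.inr i))

/-- Point accumulator of the member pass: guard, `H(x_c)` (81, FI), `∇E(x_c)` (9, FI), `F(x_c)` (3, FI), `Σ_{b lip} JF^c_b` (18, FI). -/
structure AccP where
  /-- guard -/
  ok : Bool
  /-- point Hessian -/
  H : Array FI
  /-- point gradient -/
  g : Array FI
  /-- point force -/
  fc : Array FI
  /-- point Jacobian of the Lipschitz-class labels -/
  jc : Array FI

/-- ★ LIGHT POINT RECORD: `mkDRec` without the third-derivative tables `pt`/`rt` (left empty — `hessOf`, `dF`, `jF` and the gradient do not read them;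
`thirdOf`/`ddF` are never applied to a point record).  Saves ≈ 40 % of the member pass. -/
def mkPRec (top : ℕ) (E : Fin 3 × Fin 3 → FI) (q : Fin 3 → FI) : Option DRec :=
  let qt := tab3 q
  let y := tab3 (yOf E qt)
  match coefL (dot3 y y) with
  | none => none
  | some co =>
    let dy : Array FI := Array.ofFn fun n : Fin 27 => if n.val / 3 < top then d1 E qt (n.val / 3) ⟨n.val % 3, by omega⟩ else fi0
    let gd := fun (a : ℕ) (c : ℕ) => dy.getD (3 * a + c) fi0
    let ze : Array FI := Array.ofFn fun a : Fin 9 =>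
      if a.val < top then (((y 0).mul (gd a.val 0)).add ((y 1).mul (gd a.val 1))).add ((y 2).mul (gd a.val 2)) else fi0
    let nu : Array FI := Array.ofFn fun n : Fin 81 =>
      let a := n.val / 9
      let b := n.val % 9
      if a ≤ b ∧ b < top then
        let dd := (((gd a 0).mul (gd b 0)).add ((gd a 1).mul (gd b 1))).add ((gd a 2).mul (gd b 2))
        let yd := (((y 0).mulInt (d2 a b 0)).add ((y 1).mulInt (d2 a b 1))).add ((y 2).mulInt (d2 a b 2))
        dd.add yd
      else fi0
    some ⟨y, dy, ze, nu, co, #[], #[]⟩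

/-- ★ The member's POINT pass over the class label lists. -/
def pointPass (K : ClassData) (c : (Fin 3 × Fin 3) ⊕ Fin 3 → ℤ) (aP : Fin 3 → Fin 6 → ℤ) : AccP :=
  let EP := cenE c
  let XP := cenX c
  let P0 : AccP := ⟨true, zeroArr 81, zeroArr 9, zeroArr 3, zeroArr 18⟩
  let P1 := K.LA.foldl (fun P b =>
    match mkPRec 6 EP (pA b) with
    | none => ⟨false, P.H, P.g, P.fc, P.jc⟩
    | some Rp =>
      let gb : Array FI := Array.ofFn fun a : Fin 9 => if 6 ≤ a.val then fi0 else Rp.co.be.mul (Rp.z a.val)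
      ⟨P.ok, addArr 81 P.H (hessOf Rp true), addArr 9 P.g gb, P.fc, P.jc⟩) P0
  let stepB := fun (lip : Bool) (P : AccP) (b : Fin 3 → ℤ) =>
    match mkPRec 9 EP (qB XP b) with
    | none => ⟨false, P.H, P.g, P.fc, P.jc⟩
    | some Rp =>
      let gb : Array FI := Array.ofFn fun a : Fin 9 => Rp.co.be.mul (Rp.z a.val)
      let fc := Array.ofFn fun a : Fin 3 => (P.fc.getD a.val fi0).add (Rp.co.be.mul (Rp.y a))
      let jc := if lip then Array.ofFn fun n : Fin 18 => (P.jc.getD n.val fi0).add (jF aP Rp ⟨n.val / 6, by omega⟩ (n.val % 6)) else P.jc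
      ⟨P.ok, addArr 81 P.H (hessOf Rp false), addArr 9 P.g gb, fc, jc⟩
  let P2 := K.LBlip.foldl (stepB true) P1
  K.LBhull.foldl (stepB false) P2

/-- ★★★ **THE CLASS-AMORTISED NEAR REPORT** `t2NearK K win n μ c w aP = ((flag, V₀ − μ, boxMin₆, penP, penJ, pen0, κ, LB − μ), (G₀, G₁, G₂))` in `SC` units:
Design-J-shaped value leaf at the track with the class tensors `Λ^K`, `R^K` contracted against the member's own half-widths, and the §14b slope with `S^K`, `J^K`;
`flag` includes `memberOK`. -/
def t2NearK (K : ClassData) (win : ℤ) (n : ℕ) (μ : ℤ) (c w : (Fin 3 × Fin 3) ⊕ Fin 3 → ℤ) (aP : Fin 3 → Fin 6 → ℤ) :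
    (Bool × ℤ × ℤ × ℤ × ℤ × ℤ × ℤ × ℤ) × (ℤ × ℤ × ℤ) :=
  let w' := trackW aP w
  let wf : Array ℤ := Array.ofFn fun p : Fin 9 => foldW w' p
  let wu := wfU wf
  let P := pointPass K c aP
  let HT := hessTrack aP P.H
  let gT := gradTrack aP P.g
  let Hc : Array ℤ := HT.map cen
  let Hr : Array ℤ := HT.map rad
  let gc : Array ℤ := gT.map cen
  let gr : Array ℤ := gT.map rad
  -- class tensors contracted with the member's own widths
  let pen6 : ℤ := (List.range 9).foldl (fun s a => (List.range 9).foldl (fun s2 b => if b < a then s2 else (List.range 9).foldl (fun s3 m =>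
      if m < b then s3 else s3 + K.lam.getD (81 * a + 9 * b + m) 0 * wf.getD a 0 * wf.getD b 0 / (SC : ℤ) * wf.getD m 0) s2) s) 0
  let pL : ℤ := cdiv pen6 (6 * (SC : ℤ) * (SC : ℤ))
  let p0 : ℤ := cdiv ((List.range 81).foldl (fun s n => s + K.r0.getD n 0 * wf.getD (n / 9) 0 * wf.getD (n % 9) 0) 0) (2 * (SC : ℤ) * (SC : ℤ))
  let f := fun (a : ℕ) => (P.fc.getD a fi0).absHi
  let j := fun (a : ℕ) => cdiv ((List.range 6).foldl (fun s e => s + (P.jc.getD (6 * a + e) fi0).absHi * wf.getD e 0) 0) (SC : ℤ)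
  let h := fun (a : ℕ) => cdiv ((List.range 6).foldl (fun s e => s + K.jh.getD (6 * a + e) 0 * wf.getD e 0) 0) (SC : ℤ)
  let r := fun (a : ℕ) => cdiv ((List.range 81).foldl (fun s n => if n % 9 < n / 9 then s else
      s + K.s2.getD (81 * a + n) 0 * wf.getD (n / 9) 0 / (SC : ℤ) * wf.getD (n % 9) 0) 0) (2 * (SC : ℤ))
  let G := fun (a : ℕ) => f a + j a + h a + r a
  let okAll := memberOK K c w' && foldGuard c w' && K.ok && P.ok && symOK Hc
  match valuePW win n μ c, kappaShift Hc with
  | some v, some κ =>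
    let t := anchor Hc gc wu 40
    let bm := boxMin Hc gc wu κ t
    let pP : ℤ := cdiv ((List.range 9).foldl (fun s k => s + gr.getD k 0 * wu.getD k 0) 0) (SC : ℤ) +
      cdiv ((List.range 9).foldl (fun s k => (List.range 9).foldl (fun s2 l => s2 + (Hr.getD (9 * k + l) 0) * wu.getD k 0 * wu.getD l 0) s) 0)
        (2 * (SC : ℤ) * (SC : ℤ))
    ((okAll, v - μ, bm, pP, pL, p0, κ, v + bm - pP - pL - p0 - μ), (G 0, G 1, G 2))
  | some v, none => ((false, v - μ, 0, 0, 0, 0, -1, 0), (G 0, G 1, G 2))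
  | none, _ => ((false, 0, 0, 0, 0, 0, 0, 0), (G 0, G 1, G 2))

end Summit.AtomisticToContinuum.Crystallization.Theorems.FrustratedLawDichotomyStrainedPatchHomValueT2Kit
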